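import Summits.BirchSwinnertonDyer.Rank1Residual.X11b.SelmerTorsionControl
import Mathlib.RingTheory.QuotSMulTop
import HarnessLib

/-!
# Erratum Lemma 2.1 ∕ [JSW17, Lemma 3.4.1] with FINITE defect, Selmer side (abstract): the quotient
# `Sel(M)[r] / H¹(ι)(Sel(M[r]))` is finite when the constrained local invariants have finite `r`-cotorsion
# at finitely many places and are `r`-divisible at the others (helper, `--supports stmt-BirchSwinnertonDyer-25505`)

Cell `bsd-stepL`, seat `bsd-stepL-imc-p1` (prover g22, 2026-08-28). Theorems only (no definition, no named fact, no
`sorry`, no instance, no notation). Companion of `Rank1Residual/X11b/SelmerTorsionControl.lean`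
(`TorsionControl.map_torsionInclH1_selmer`: `H¹(ι)(Sel(M[r])) = Sel(M)[r]` when ALL constrained local invariants are
`r`-divisible — the EXACT case) and the Selmer half of the v4 stub `stub_controlAnomalous` of line `erratum_chain` of
crux 25505 `ErratumThm23SigmaLe` (memo `HOME/imc-p1/g22/CORNER-25505-imc-p1-g22.md` §2, §4(b)).

## What is proved

Setting of `TorsionControl` (a topological group `Γ`, continuous `φ_v : Γ_v → Γ`, constrained indices `L ⊆ ι`, a discrete
`A`-linear `Γ`-module `M` on which `r ∈ A` acts surjectively). Let `L₀` be a FINITE set of constrained indices such that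
at every other constrained `v` the local invariants `M^{Γ_v}` are `r`-divisible, while at `v ∈ L₀` the `r`-cotorsion
`M^{Γ_v} / r·M^{Γ_v}` (`QuotSMulTop r ↥(invariants)`) is FINITE. Then

* `finite_selmer_torsion_quot` — **`Sel(M)[r] / H¹(ι)(Sel(M[r]))` is finite.** Proof ([JSW17] p. 14: "the cokernel … is a quotient
  of `𝓜^{G_{K_v}}/(γ₊ − 1)𝓜^{G_{K_v}}`"): a class `y ∈ Sel(M)` with `r y = 0` lifts to `x ∈ H¹(Γ, M[r])`; at a constrained `v` its
  restriction dies in `H¹(Γ_v, M)`, so it is `δ₀,v` of a local invariant — zero where the invariants are `r`-divisible, and an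
  element of the FINITE set `δ₀,v(M^{Γ_v}) ≅ M^{Γ_v}/r` for `v ∈ L₀` (`δ₀,v` kills `r·M^{Γ_v}`); two classes with the same
  `L₀`-signature differ by `H¹(ι)` of a class of `Sel(M[r])`. No hypothesis on the global invariants is needed.

HONEST FRAMING: cohomological bookkeeping for abstract data; nothing about any newform or curve is asserted; BSD is proved for no
pair; closes: none (T7).

## References
* [JetchevSkinnerWan2017] §3.4, display before Lemma 3.4.1 and Lemma 3.4.1 (arXiv:1512.06894 p. 14).
* [Castella2018Erratum] Lemma 2.1 (p. 2). [SerreGaloisCohomology1997] I §2.2 (connecting homomorphism).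
-/

noncomputable section

open CategoryTheory Literature.NumberTheory.GaloisRepresentations
open scoped ContRepresentation Pointwise

universe u

-- D-0017: single-problem summit, the namespace repeats the problem name by design.
set_option linter.dupNamespace false
set_option autoImplicit false

namespace Summit.BirchSwinnertonDyer.BirchSwinnertonDyer.Theorems.ErratumThm23TwoVariable.SelmerFiniteDefect

open Summit.BirchSwinnertonDyer.Rank1Residual.X11b.TorsionControl

variable {A : Type*} [CommRing A] [TopologicalSpace A]
variable {Γ : Type u} [Group Γ] [TopologicalSpace Γ] [IsTopologicalGroup Γ]
variable {M : Type u} [AddCommGroup M] [Module A M] [TopologicalSpace M] [DiscreteTopology M]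
  [ContinuousSMul A M]
variable {ι : Type*} {Γv : ι → Type u} [∀ v, Group (Γv v)] [∀ v, TopologicalSpace (Γv v)]
  [∀ v, IsTopologicalGroup (Γv v)] (φ : ∀ v, Γv v →ₜ* Γ) (L : Set ι)
  (ρ : ContinuousRep Γ A M) (r : A)

/-- **The local connecting map kills `r · M^{Γ_v}`**: `δ₀,v (r • w) = 0` for an invariant `w` (exactness at
`M^{Γ_v}` of `M^{Γ_v} →ʳ M^{Γ_v} →δ H¹(Γ_v, M[r])`). [cite: SerreGaloisCohomology1997, I §2.2] -/
theorem smul_top_le_ker_δ₀ {H : Type u} [Group H] [TopologicalSpace H] [IsTopologicalGroup H]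
    (ρ' : ContinuousRep H A M) (hr : Function.Surjective fun m : M => r • m) :
    (r • (⊤ : Submodule A ↥(ρ'.toTopRep.ρ.invariants))) ≤ LinearMap.ker (isSES_torsion ρ' r hr).δ₀ := by
  intro z hz
  rw [Submodule.mem_smul_pointwise_iff_exists] at hz
  obtain ⟨w, -, rfl⟩ := hz
  rw [LinearMap.mem_ker, (isSES_torsion ρ' r hr).δ₀_eq_zero_iff]
  exact ⟨w, w.2, rfl⟩

/-- **The range of the local connecting map is finite when `M^{Γ_v}/r·M^{Γ_v}` is** (it factors through
`QuotSMulTop r ↥(M^{Γ_v})`). [cite: SerreGaloisCohomology1997, I §2.2] -/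
theorem finite_range_δ₀ {H : Type u} [Group H] [TopologicalSpace H] [IsTopologicalGroup H]
    (ρ' : ContinuousRep H A M) (hr : Function.Surjective fun m : M => r • m)
    (hfin : Finite (QuotSMulTop r ↥(ρ'.toTopRep.ρ.invariants))) :
    (Set.range (isSES_torsion ρ' r hr).δ₀).Finite := by
  haveI := hfin
  have heq : Set.range (isSES_torsion ρ' r hr).δ₀ =
      Set.range ((r • (⊤ : Submodule A ↥(ρ'.toTopRep.ρ.invariants))).liftQ
        (isSES_torsion ρ' r hr).δ₀ (smul_top_le_ker_δ₀ r ρ' hr)) := by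
    ext x
    constructor
    · rintro ⟨w, rfl⟩
      exact ⟨Submodule.Quotient.mk w, rfl⟩
    · rintro ⟨q, rfl⟩
      induction q using Submodule.Quotient.induction_on with
      | H w => exact ⟨w, rfl⟩
  rw [heq]
  exact Set.finite_range _

/-- **Erratum Lemma 2.1 ∕ [JSW17, L. 3.4.1] with finite defect, Selmer side.** For `r`-divisible `M`, a finite set
`L₀ ⊆ L` of constrained indices with FINITE `r`-cotorsion of the local invariants `M^{Γ_v}/r·M^{Γ_v}` (`v ∈ L₀`) and
`r`-DIVISIBLE local invariants at every other constrained `v`: the quotient of `Sel(M)[r] = Sel(M) ⊓ H¹(Γ, M)[r]` by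
`H¹(ι)(Sel(M[r]))` is FINITE ("the cokernel of `H¹_{ac}(K, M) ↪ H¹_{Gr}(K, 𝓜)[γ₊ − 1]` is a quotient of
`⊕ 𝓜^{G_{K_v}}/(γ₊ − 1)𝓜^{G_{K_v}}`, it is therefore finite").
[cite: JetchevSkinnerWan2017, §3.4, Lemma 3.4.1 (arXiv:1512.06894 p. 14)] [cite: Castella2018Erratum, Lemma 2.1 (p. 2)] -/
theorem finite_selmer_torsion_quot (hr : Function.Surjective fun m : M => r • m)
    (L₀ : Finset ι) (hL₀ : ∀ v ∈ L₀, v ∈ L)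
    (hloc : ∀ v ∈ L, v ∉ L₀ → ∀ w ∈ ((ρ.restrict (φ v)).toTopRep).ρ.invariants,
      ∃ w' ∈ ((ρ.restrict (φ v)).toTopRep).ρ.invariants, r • w' = w)
    (hfin : ∀ v ∈ L₀, Finite (QuotSMulTop r ↥(((ρ.restrict (φ v)).toTopRep).ρ.invariants))) :
    Finite (↥(selmer φ L ρ ⊓ Submodule.torsionBy A (continuousCohomology 1 ρ.toTopRep) r) ⧸
      Submodule.comap (selmer φ L ρ ⊓ Submodule.torsionBy A (continuousCohomology 1 ρ.toTopRep) r).subtype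
        (Submodule.map (torsionInclH1 ρ r) (selmer φ L (torsionRep ρ r)))) := by
  classical
  set S := selmer φ L ρ ⊓ Submodule.torsionBy A (continuousCohomology 1 ρ.toTopRep) r with hS
  set I := Submodule.comap S.subtype (Submodule.map (torsionInclH1 ρ r) (selmer φ L (torsionRep ρ r)))
    with hI
  -- a lift of every `r`-torsion Selmer class to `H¹(Γ, M[r])`
  have hlift : ∀ y : S, ∃ x : continuousCohomology 1 (torsionRep ρ r).toTopRep,
      cohomologyMap (torsionIncl ρ r) 1 x = (y : continuousCohomology 1 ρ.toTopRep) := fun y ↦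
    exists_cohomologyMap_torsionIncl_eq ρ r hr y.1 ((Submodule.mem_torsionBy_iff r _).1 y.2.2)
  choose lift hlift using hlift
  -- the local connecting maps at `v ∈ L₀` and their finite ranges
  have hfr : ∀ v : (L₀ : Set ι), (Set.range (isSES_torsion (ρ.restrict (φ v)) r hr).δ₀).Finite :=
    fun v ↦ finite_range_δ₀ r (ρ.restrict (φ v)) hr (hfin v v.2)
  haveI : ∀ v : (L₀ : Set ι), Finite ↥(Set.range (isSES_torsion (ρ.restrict (φ v)) r hr).δ₀) :=
    fun v ↦ (hfr v).to_subtype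
  -- the restriction of a lift at a constrained `v` dies in `H¹(Γ_v, M)`, hence is `δ₀,v` of a local invariant
  have hres : ∀ (y : S) (v : ι), v ∈ L →
      resH1 (torsionRep ρ r) (φ v) (lift y) ∈ Set.range (isSES_torsion (ρ.restrict (φ v)) r hr).δ₀ := by
    intro y v hv
    obtain ⟨w, hw⟩ := (cohomologyMap_torsionIncl_eq_zero_iff (ρ.restrict (φ v)) r hr
      (resH1 (torsionRep ρ r) (φ v) (lift y))).1 (by
        have h := resH1_cohomologyMap (φ v) (torsionIncl ρ r) (lift y)
        rw [hlift] at h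
        change (cohomologyMap (restrictHom (φ v) (torsionIncl ρ r)) 1)
          (resH1 (torsionRep ρ r) (φ v) (lift y)) = 0
        rw [← h]
        exact (mem_selmer_iff φ L ρ _).1 y.2.1 v hv)
    exact ⟨w, hw⟩
  -- the `L₀`-signature of a class
  let Ψ : S → ∀ v : (L₀ : Set ι), ↥(Set.range (isSES_torsion (ρ.restrict (φ v)) r hr).δ₀) :=
    fun y v ↦ ⟨resH1 (torsionRep ρ r) (φ v) (lift y), hres y v (hL₀ v v.2)⟩
  -- two classes with the same signature differ by `H¹(ι)` of a class of `Sel(M[r])`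
  have hΨ : ∀ y₁ y₂ : S, Ψ y₁ = Ψ y₂ → y₁ - y₂ ∈ I := by
    intro y₁ y₂ h
    have hd : ∀ v ∈ L, resH1 (torsionRep ρ r) (φ v) (lift y₁ - lift y₂) = 0 := by
      intro v hv
      rw [map_sub, sub_eq_zero]
      by_cases hv₀ : v ∈ L₀
      · exact congrArg Subtype.val (congrFun h ⟨v, hv₀⟩)
      · -- off `L₀`: the local `H¹(ι)` is injective (divisible invariants) and both restrictions die in `H¹(Γ_v, M)`
        apply cohomologyMap_torsionIncl_injective (ρ.restrict (φ v)) r hr (hloc v hv hv₀)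
        have h₁ := resH1_cohomologyMap (φ v) (torsionIncl ρ r) (lift y₁)
        have h₂ := resH1_cohomologyMap (φ v) (torsionIncl ρ r) (lift y₂)
        rw [hlift] at h₁ h₂
        change cohomologyMap (restrictHom (φ v) (torsionIncl ρ r)) 1 (resH1 (torsionRep ρ r) (φ v) (lift y₁)) =
          cohomologyMap (restrictHom (φ v) (torsionIncl ρ r)) 1 (resH1 (torsionRep ρ r) (φ v) (lift y₂))
        rw [← h₁, ← h₂, (mem_selmer_iff φ L ρ _).1 y₁.2.1 v hv, (mem_selmer_iff φ L ρ _).1 y₂.2.1 v hv]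
    have hmem : lift y₁ - lift y₂ ∈ selmer φ L (torsionRep ρ r) := (mem_selmer_iff φ L _ _).2 hd
    rw [hI, Submodule.mem_comap, Submodule.mem_map]
    refine ⟨lift y₁ - lift y₂, hmem, ?_⟩
    rw [torsionInclH1_apply, map_sub, hlift, hlift]
    rfl
  -- conclude: the signature descends to an injection of the quotient into a finite type
  refine Finite.of_injective (fun q : ↥S ⧸ I ↦ Ψ q.out) fun q₁ q₂ h ↦ ?_
  have e : (Submodule.Quotient.mk q₁.out : ↥S ⧸ I) = Submodule.Quotient.mk q₂.out :=
    (Submodule.Quotient.eq I).2 (hΨ _ _ h)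
  have h₁ : (Submodule.Quotient.mk q₁.out : ↥S ⧸ I) = q₁ := Quotient.out_eq q₁
  have h₂ : (Submodule.Quotient.mk q₂.out : ↥S ⧸ I) = q₂ := Quotient.out_eq q₂
  rw [h₁, h₂] at e
  exact e

end Summit.BirchSwinnertonDyer.BirchSwinnertonDyer.Theorems.ErratumThm23TwoVariable.SelmerFiniteDefect

end
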